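import Summits.BirchSwinnertonDyer.Rank1Residual.X2.PrimeOrderCharacters
import Literature.NumberTheory.EllipticCurves.ZpExtension
import Literature.NumberTheory.EllipticCurves.GreenbergSelmer
import Literature.NumberTheory.EllipticCurves.SelmerCorankProofs
import Literature.GroupTheory.PadicIntCompactImageProofs
import HarnessLib

/-!
# Crux K1 `CumulativeHeegnerInclusionAtThree` (stmt-BirchSwinnertonDyer-24198), line `birth`, stub B1 —
# CELL TRANSPORT II: a Galois module of order `p` on which `G_{K_{∞,w}}` acts trivially is acted on
# trivially by `G_{K_w}` (no `p`-torsion is gained up a `ℤ_p`-tower at a character of order prime to `p`)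

Lead prover bsd-line-chl-k1-p1 g2 (`--supports stmt-BirchSwinnertonDyer-24198`). The devissage reduction of
stub B1 (tree `…CumulativeHeegnerInclusionAtThreeResidualDevissage.finite_selmerAc_empty_pTorsion_of_line_devissage`)
asks that the quotient `E_K[3]/Φ_K` have NO non-zero element fixed by `ker κ ⊓ D_{𝔭′}` — the absolute
Galois group of the completion of `K_∞` at the chosen place above `𝔭′` — whereas the crux's non-anomalous
clause (transported to `K` in `…LineBaseChange`) only says that the whole decomposition group `D_{𝔭′}`
does not act trivially. The gap is the elementary fact proved here, for ANY `ℤ_p`-extension `κ` of a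
number field `K`, any finite place `w` and any `Γ_K`-module `A` of order `p`:

* §1 **`forall_decomp_smul_eq_of_forall_inf`** — if `ker κ ⊓ decomp w` acts trivially on `A` then so
  does `decomp w`. Proof: `Γ_K` acts on `A` through a character `χ : Γ_K → 𝔽_pˣ`
  (`X2.PrimeOrderCharacters.exists_character_of_natCard_eq`), of exponent `p − 1` (Fermat); the image of
  the compact group `Γ_{K_w}` under `κ` is `0` or `p^e ℤ_p` (tree `GroupTheory.kappa_eq_one_or_exists_image_eq_span_pow`),
  a group on which `p − 1` is invertible, so every `g ∈ D_w` is `d^{p−1} · h` with `d ∈ D_w` and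
  `h ∈ ker κ ⊓ D_w`; both factors act trivially.
* §2 **`eq_zero_of_fixed_of_not_forall_decomp_smul_eq`** — contrapositive in the shape consumed by the
  devissage (`hfix`): if `decomp w` does NOT act trivially on `A`, then `A` has no non-zero element fixed by
  `ker κ ⊓ decomp w` (a non-zero fixed element generates `A`).

For the Leopoldt cell (`p = 3`, `A = E_K[3]/Φ_K` or `Φ_K`, characters `χ_{-1}`, `χ_3` at `3`) this is the
remark that an order-`2` character of `G_{ℚ_3}` stays non-trivial on every subgroup with pro-`3` quotient.
THEOREMS ONLY; no definition, no named fact, no `sorry`; imports no `Theses` module. BSD is not proved by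
any of this. References: [SerreGaloisCohomology1997] I §1.4 (closed subgroups of `ℤ_p`); [WashingtonCyclotomic1997]
§13.1; [GreenbergVatsal2000] §2 p. 28 (characters of `Φ`, `Ψ`).
-/

set_option autoImplicit false
-- `…BirchSwinnertonDyer.BirchSwinnertonDyer.Theorems…` is the problem's mandated namespace (D-0017).
set_option linter.dupNamespace false

noncomputable section

open scoped Classical

namespace Summit.BirchSwinnertonDyer.BirchSwinnertonDyer.Theorems.CumulativeHeegnerInclusionAtThreeTowerFixed

open NumberField IsDedekindDomain Field Multiplicative
open Literature.NumberTheory.EllipticCurves Literature.NumberTheory.EllipticCurves.GreenbergSelmer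
  Literature.NumberTheory.GaloisRepresentations
  Summit.BirchSwinnertonDyer.Rank1Residual.X2.PrimeOrderCharacters

variable {K : Type} [Field K] [NumberField K] {p : ℕ} [hp : Fact p.Prime] (κ : ZpExtension K p)
  (w : HeightOneSpectrum (𝓞 K)) {A : Type*} [AddCommGroup A] [DistribMulAction (absoluteGaloisGroup K) A]

/-! ### §1 Triviality on `ker κ ⊓ D_w` forces triviality on `D_w` for a module of order `p` -/

/-- `p - 1` is a unit of `ℤ_p`. [folklore] -/
theorem isUnit_natCast_sub_one : IsUnit ((p - 1 : ℕ) : ℤ_[p]) := by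
  rw [PadicInt.isUnit_iff]
  refine le_antisymm (PadicInt.norm_le_one _) ?_
  by_contra hlt
  rw [not_le] at hlt
  have h : ‖(((p - 1 : ℕ) : ℤ) : ℤ_[p])‖ < 1 := by rwa [Int.cast_natCast]
  rw [PadicInt.norm_int_lt_one_iff_dvd] at h
  have h' : p ∣ p - 1 := by exact_mod_cast h
  have hp2 := hp.out.two_le
  have := Nat.le_of_dvd (by omega) h'
  omega

/-- **If `ker κ ⊓ D_w` acts trivially on a `Γ_K`-module `A` of order `p`, so does `D_w`.** The action is
through a character `χ : Γ_K → 𝔽_pˣ` (of exponent `p − 1`); the image of the compact `Γ_{K_w}` under the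
continuous `κ` is `0` or an ideal `p^e ℤ_p`, on which `p − 1` is invertible: for `g ∈ D_w` pick `d ∈ D_w`
with `(p − 1) κ(d) = κ(g)`, so `g = d^{p−1} · h` with `h ∈ ker κ ⊓ D_w`, and `χ(d)^{p−1} = 1`.
[cite: SerreGaloisCohomology1997, I §1.4 (closed subgroups of ℤ_p are 0 or p^e ℤ_p)] -/
theorem forall_decomp_smul_eq_of_forall_inf (hA : Nat.card A = p)
    (h : ∀ g ∈ κ.kerSubgroup ⊓ decomp w, ∀ a : A, g • a = a) :
    ∀ g ∈ decomp w, ∀ a : A, g • a = a := by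
  obtain ⟨χ, hχ⟩ := exists_character_of_natCard_eq (G := absoluteGaloisGroup K) (A := A) hA
  -- powers `p - 1` act trivially
  have hpow : ∀ (d : absoluteGaloisGroup K) (a : A), d ^ (p - 1) • a = a := fun d a ↦ by
    rw [hχ, map_pow, ZMod.units_pow_card_sub_one_eq_one, Units.val_one, ZMod.val_one, one_smul]
  -- the image of `Γ_{K_w}` under `κ`
  haveI : CharZero (w.adicCompletion K) :=
    charZero_of_injective_algebraMap (algebraMap K (w.adicCompletion K)).injective
  haveI : CompactSpace (absoluteGaloisGroup (w.adicCompletion K)) :=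
    compactSpace_absoluteGaloisGroup (w.adicCompletion K)
  let κD : absoluteGaloisGroup (w.adicCompletion K) →ₜ* Multiplicative ℤ_[p] :=
    κ.toContinuousMonoidHom.comp (absGaloisRestrict K (w.adicCompletion K))
  have hκD : ∀ σ, κD σ = κ (absGaloisRestrict K (w.adicCompletion K) σ) := fun _ ↦ rfl
  intro g hg a
  obtain ⟨σ, rfl⟩ := (mem_decomp_iff w g).mp hg
  rcases Literature.GroupTheory.kappa_eq_one_or_exists_image_eq_span_pow κD with h1 | ⟨e, hmem, hsurj⟩
  · -- `κ` trivial on `D_w`: then `g ∈ ker κ ⊓ D_w`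
    refine h _ (Subgroup.mem_inf.mpr ⟨?_, hg⟩) a
    rw [ZpExtension.mem_kerSubgroup, ← hκD, h1 σ]
  · -- `κ(D_w) = p^e ℤ_p`: write `κ g = (p-1) • c` with `c` a value
    obtain ⟨u, hu⟩ := isUnit_natCast_sub_one (p := p)
    set x : ℤ_[p] := toAdd (κD σ) with hx
    have hc : (↑u⁻¹ : ℤ_[p]) * x ∈ Ideal.span {(p : ℤ_[p]) ^ e} := Ideal.mul_mem_left _ _ (hmem σ)
    obtain ⟨δ, hδ⟩ := hsurj _ hc
    set d : absoluteGaloisGroup K := absGaloisRestrict K (w.adicCompletion K) δ with hd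
    have hdD : d ∈ decomp w := (mem_decomp_iff w d).mpr ⟨δ, rfl⟩
    -- `κ (d ^ (p-1)) = κ g`
    have hkey : κ (d ^ (p - 1)) = κ (absGaloisRestrict K (w.adicCompletion K) σ) := by
      apply toAdd.injective
      have e1 : toAdd (κ d) = (↑u⁻¹ : ℤ_[p]) * x := by rw [hd, ← hκD, hδ]
      rw [map_pow, toAdd_pow, e1, nsmul_eq_mul, ← mul_assoc, ← hu, Units.mul_inv, one_mul, hx, hκD]
    -- `h := (d^(p-1))⁻¹ * g ∈ ker κ ⊓ D_w`
    have hH : (d ^ (p - 1))⁻¹ * absGaloisRestrict K (w.adicCompletion K) σ ∈ κ.kerSubgroup ⊓ decomp w := by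
      refine Subgroup.mem_inf.mpr
        ⟨?_, (decomp w).mul_mem ((decomp w).inv_mem ((decomp w).pow_mem hdD _)) hg⟩
      rw [ZpExtension.mem_kerSubgroup, map_mul, map_inv, hkey, inv_mul_cancel]
    have := h _ hH a
    calc absGaloisRestrict K (w.adicCompletion K) σ • a
        = (d ^ (p - 1) * ((d ^ (p - 1))⁻¹ * absGaloisRestrict K (w.adicCompletion K) σ)) • a := by
          rw [mul_inv_cancel_left]
      _ = a := by rw [mul_smul, this, hpow]

/-! ### §2 The shape consumed by the devissage: no non-zero `ker κ ⊓ D_w`-fixed element -/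

/-- **No non-zero element of a `Γ_K`-module of order `p` is fixed by `ker κ ⊓ D_w` when `D_w` acts
non-trivially** (`ker κ ⊓ D_w = G_{K_{∞,w}}` for the chosen place of `K_∞` above `w`): a non-zero fixed
element generates the cyclic group `A`, so `ker κ ⊓ D_w` would act trivially, hence `D_w` would (§1).
[cite: SerreGaloisCohomology1997, I §1.4] [cite: GreenbergVatsal2000, §2 p. 28] -/
theorem eq_zero_of_fixed_of_not_forall_decomp_smul_eq (hA : Nat.card A = p)
    (hnon : ¬ ∀ g ∈ decomp w, ∀ a : A, g • a = a) (y : A)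
    (hy : ∀ g : ↥(κ.kerSubgroup ⊓ decomp w), g • y = y) : y = 0 := by
  by_contra hy0
  apply hnon
  apply forall_decomp_smul_eq_of_forall_inf κ w hA
  intro g hg a
  have htop : AddSubgroup.zmultiples y = ⊤ := zmultiples_eq_top_of_prime_card hA hy0
  have ha : a ∈ AddSubgroup.zmultiples y := by rw [htop]; exact AddSubgroup.mem_top a
  obtain ⟨k, rfl⟩ := AddSubgroup.mem_zmultiples_iff.mp ha
  have hgy : g • y = y := hy ⟨g, hg⟩
  rw [smul_comm g k y, hgy]

end Summit.BirchSwinnertonDyer.BirchSwinnertonDyer.Theorems.CumulativeHeegnerInclusionAtThreeTowerFixed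

end
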